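import Summits.SmoothPoincare4.SmoothPoincare4.Theorems.CylinderEntropyCylinderRungTwoFluxIdentityPushOff
import HarnessLib

/-!
# Far points of `N = S⁴ × ℝ` are joined off a set of bounded height

Registered helper `helper_farPointsJoined` (wave 1, brick W2) of line `killing-flux` of the crux
`CylinderEntropy.CylinderRungTwo` (stmt-SmoothPoincare4-7631). Everything here is proved
(no named facts); theorems only.

Let `N = {z ∈ ℝ⁶ | ∑_{i<5} zᵢ² = 1} = S⁴ × ℝ` and let `A ⊆ ℝ⁶` have all heights `|z₅| < R`.
Then any two points of `N` of height `≥ R` are joined by a path in `N ∖ A`, and so are any two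
points of height `≤ -R`.

*Proof.* More generally, if the heights of `A` avoid an order-connected set `S ⊆ ℝ` of heights,
then two points `a = (p, s)`, `b = (q, t)` of `N` with `s, t ∈ S` are joined in `N ∖ A`: go along
the vertical segment `{p} × [s, t]` (heights in `S` by order-connectedness, so off `A`; in `N` by
`vert_mem_Ncyl`), then inside the slice `S⁴ × {t}`, which is path connected (the continuous image
`y ↦ (y, t)` of the round sphere `S⁴ ⊂ ℝ⁵`, `isPathConnected_sphere`) and misses `A` (`t ∈ S`).
Apply this with `S = [R, ∞)` and `S = (-∞, -R]`.
-/

-- the prescribed namespace `Summit.SmoothPoincare4.SmoothPoincare4.…` repeats `SmoothPoincare4`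
set_option linter.dupNamespace false

noncomputable section

open MeasureTheory Set Function Filter Module
open scoped Manifold ContDiff ENNReal Topology RealInnerProductSpace NNReal

namespace Summit.SmoothPoincare4.SmoothPoincare4.Theorems.CylinderRungTwo.KillingFlux

open Literature.Geometry.Riemannian
open Literature.Geometry.Lorentzian Literature.Geometry.Lorentzian.PseudoRiemannianMetric
open Literature.Geometry.Riemannian.SphericalCylinderEntropy (truncL truncL_apply)
open Literature.Geometry.Manifold.CylinderSlice (axis padL sliceMap sliceMap_eq_comp range_sliceMap)

section FarPoints

/-- The slice `S⁴ × {c} = {z ∈ N | z₅ = c}` of the cylinder is path connected: it is the image of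
the round sphere `S⁴ ⊂ ℝ⁵` under the continuous map `y ↦ (y, c)`. [folklore] -/
theorem isPathConnected_slice (c : ℝ) :
    IsPathConnected {z : EuclideanSpace ℝ (Fin 6) | ∑ i : Fin 5, z (Fin.castSucc i) ^ 2 = 1 ∧ z 5 = c} := by
  rw [← range_sliceMap c, sliceMap_eq_comp, Set.range_comp, Subtype.range_coe]
  refine (isPathConnected_sphere ?_ (0 : EuclideanSpace ℝ (Fin 5)) zero_le_one).image
    (f := fun y : EuclideanSpace ℝ (Fin 5) => padL y + c • (axis : EuclideanSpace ℝ (Fin 6))) ?_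
  · rw [← Module.finrank_eq_rank, finrank_euclideanSpace_fin]; norm_num
  · exact padL.continuous.add continuous_const

/-- A vertical segment `{p} × [s₀, s₁]` over a point `p ∈ S⁴` missing `A` joins its endpoints in
`N ∖ A` (the tree lemma `joinedIn_vert` for the inclusion `A ↪ ℝ⁶`). [folklore] -/
theorem joinedIn_vert_of_forall_notMem {A : Set (EuclideanSpace ℝ (Fin 6))} {p : EuclideanSpace ℝ (Fin 5)}
    (hp : ∑ i : Fin 5, p i ^ 2 = 1) {s₀ s₁ : ℝ}
    (h : ∀ s ∈ Set.uIcc s₀ s₁, padL p + s • (axis : EuclideanSpace ℝ (Fin 6)) ∉ A) :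
    JoinedIn (({z : EuclideanSpace ℝ (Fin 6) | ∑ i : Fin 5, z (Fin.castSucc i) ^ 2 = 1} :
        Set (EuclideanSpace ℝ (Fin 6))) \ A)
      (padL p + s₀ • (axis : EuclideanSpace ℝ (Fin 6))) (padL p + s₁ • (axis : EuclideanSpace ℝ (Fin 6))) := by
  have key := joinedIn_vert (M := A) (ι := ((↑) : A → EuclideanSpace ℝ (Fin 6))) hp (s₀ := s₀) (s₁ := s₁)
  rw [Subtype.range_coe] at key
  exact key h

/-- **Joining points whose heights lie in an order-connected set avoided by `A`.** If the heights
of `A` avoid the order-connected set `S ⊆ ℝ`, then two points of `N` with heights in `S` are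
joined in `N ∖ A`: vertically over `truncL a` from height `a₅` to height `b₅`, then inside the
path-connected slice `S⁴ × {b₅}`. [folklore] -/
theorem joinedIn_of_heights_mem {A : Set (EuclideanSpace ℝ (Fin 6))} {S : Set ℝ} (hS : S.OrdConnected)
    (hA : ∀ z ∈ A, z 5 ∉ S) {a b : EuclideanSpace ℝ (Fin 6)}
    (ha : ∑ i : Fin 5, a (Fin.castSucc i) ^ 2 = 1) (hb : ∑ i : Fin 5, b (Fin.castSucc i) ^ 2 = 1)
    (ha5 : a 5 ∈ S) (hb5 : b 5 ∈ S) :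
    JoinedIn (({z : EuclideanSpace ℝ (Fin 6) | ∑ i : Fin 5, z (Fin.castSucc i) ^ 2 = 1} :
        Set (EuclideanSpace ℝ (Fin 6))) \ A) a b := by
  have hpa : ∑ i : Fin 5, (truncL a) i ^ 2 = 1 := by simpa only [truncL_apply] using ha
  have hpb : ∑ i : Fin 5, (truncL b) i ^ 2 = 1 := by simpa only [truncL_apply] using hb
  -- step 1: the vertical segment over `truncL a` from height `a 5` to height `b 5`
  have h1 : JoinedIn (({z : EuclideanSpace ℝ (Fin 6) | ∑ i : Fin 5, z (Fin.castSucc i) ^ 2 = 1} :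
        Set (EuclideanSpace ℝ (Fin 6))) \ A) a
      (padL (truncL a) + b 5 • (axis : EuclideanSpace ℝ (Fin 6))) := by
    have key := joinedIn_vert_of_forall_notMem (A := A) hpa (s₀ := a 5) (s₁ := b 5) fun s hs hsA => by
      have h5 := hA _ hsA
      rw [vert_apply_five] at h5
      exact h5 (hS.uIcc_subset ha5 hb5 hs)
    rwa [← eq_vert a] at key
  -- step 2: inside the slice at height `b 5`
  have h2 : JoinedIn (({z : EuclideanSpace ℝ (Fin 6) | ∑ i : Fin 5, z (Fin.castSucc i) ^ 2 = 1} :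
        Set (EuclideanSpace ℝ (Fin 6))) \ A) (padL (truncL a) + b 5 • (axis : EuclideanSpace ℝ (Fin 6))) b := by
    have hbs : b ∈ {z : EuclideanSpace ℝ (Fin 6) | ∑ i : Fin 5, z (Fin.castSucc i) ^ 2 = 1 ∧ z 5 = b 5} :=
      ⟨hb, rfl⟩
    refine ((isPathConnected_slice (b 5)).joinedIn _ ⟨vert_mem_Ncyl hpa (b 5), vert_apply_five _ _⟩ b
      hbs).mono ?_
    rintro z ⟨hzN, hz5⟩
    refine ⟨hzN, fun hzA => hA z hzA ?_⟩
    rw [hz5]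
    exact hb5
  exact h1.trans h2

/-- **W2: far points are joined off a set of bounded height.** If every point of `A ⊆ ℝ⁶` has
height `|z₅| < R`, then any two points of `N = S⁴ × ℝ` of height `≥ R` are joined by a path in
`N ∖ A`, and so are any two points of height `≤ -R` (vertical segments and a path in a round
slice `S⁴ × {h}`, all at heights `≥ R`, resp. `≤ -R`, hence off `A`). [folklore] -/
theorem helper_farPointsJoined : ∀ (A : Set (EuclideanSpace ℝ (Fin 6))) (R : ℝ), (∀ z ∈ A, |z 5| < R) → (∀ a b : EuclideanSpace ℝ (Fin 6), ∑ i : Fin 5, a (Fin.castSucc i) ^ 2 = 1 → ∑ i : Fin 5, b (Fin.castSucc i) ^ 2 = 1 → R ≤ a 5 → R ≤ b 5 → JoinedIn ({z : EuclideanSpace ℝ (Fin 6) | ∑ i : Fin 5, z (Fin.castSucc i) ^ 2 = 1} \ A) a b) ∧ (∀ a b : EuclideanSpace ℝ (Fin 6), ∑ i : Fin 5, a (Fin.castSucc i) ^ 2 = 1 → ∑ i : Fin 5, b (Fin.castSucc i) ^ 2 = 1 → a 5 ≤ -R → b 5 ≤ -R → JoinedIn ({z : EuclideanSpace ℝ (Fin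 6) | ∑ i : Fin 5, z (Fin.castSucc i) ^ 2 = 1} \ A) a b) := by
  intro A R hA
  refine ⟨fun a b ha hb ha5 hb5 => joinedIn_of_heights_mem (S := Set.Ici R) Set.ordConnected_Ici
      (fun z hz h5 => ?_) ha hb ha5 hb5,
    fun a b ha hb ha5 hb5 => joinedIn_of_heights_mem (S := Set.Iic (-R)) Set.ordConnected_Iic
      (fun z hz h5 => ?_) ha hb ha5 hb5⟩
  · -- `|z 5| < R ≤ z 5` is absurd
    exact lt_irrefl _ ((le_abs_self (z 5)).trans_lt ((hA z hz).trans_le h5))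
  · -- `z 5 ≤ -R < z 5` is absurd
    exact lt_irrefl _ ((abs_lt.1 (hA z hz)).1.trans_le h5)

end FarPoints

end Summit.SmoothPoincare4.SmoothPoincare4.Theorems.CylinderRungTwo.KillingFlux

end
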